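import Summits.Ventures.AbcSig.Sieve.PolyWitness

/-!
# Venture AbcSig — sieve certificates for newform orbits (decision trees of Bézout witnesses)

HONEST FRAMING. Certificate checker of a COMPUTATION cell (`pub-abcsig`). It proves NO Diophantine statement, makes no
claim on ABC or any summit, and does NOT verify the newform computation (that a list of orbits IS the new subspace at a
level is a separately NAMED hypothesis, backed by the cell's two-engine certificate, see `Recipes/BS04.lean`). What the
kernel checks here: given CERTIFIED ORBIT DATA `o` — a polynomial `F ∈ ℤ[x]` with `F(θ) = 0` and entries
`(ℓ, d_ℓ, g_ℓ)` meaning `d_ℓ · c_ℓ = g_ℓ(θ)` for the Hecke eigenvalues `c_ℓ` of the orbit — and ALLOWED TRACE SETS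
`A(ℓ) ⊂ ℤ` (the recipe's possible traces of Frobenius of the Frey curve, e.g. Bennett–Skinner Lemma 4.2), a
certificate proves `o.Eliminated A n`: there is no ring homomorphism `φ : ℤ[x] → k` into a field of characteristic `n`
with `φ(F) = 0` and `φ(g_ℓ) = d_ℓ · t_ℓ`, `t_ℓ ∈ A(ℓ)`, at every listed prime `ℓ ≠ n` — i.e. no prime `ν | n` of the
coefficient ring can carry the congruences `c_ℓ ≡ t_ℓ (mod ν)` that "the mod-`n` representation arises from this
orbit" would force. This is the IDEAL form of the Bennett–Skinner sieve [BS04, Prop. 4.3 and p. 42]; the printed NORM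
form is the depth-one special case.

* `Tree` — a decision tree: `split i kids` branches on the candidate trace `t ∈ A(ℓ_i)` of entry `i` (one child per
  `t`, adding the generator `g_i − d_i t`), `leaf us r` closes the branch with a Bézout witness `Σ u_j P_j = r`.
* `Tree.modulus fuel T o A gens : Option ℕ` — the checker: `none` if some witness or coverage test fails, else the
  MODULUS `R` = product of `ℓ_i` over the splits and `|r|` over the leaves. THEOREM `Tree.modulus_sound`: every prime
  `n ∤ R` is eliminated (the factor `ℓ_i` excuses `n = ℓ_i`, where the recipe gives no congruence).
* `OrbitCert` — several trees plus an integer relation `Σ z_j R_j = ∏ p^e` over their moduli with all `p` prime: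
  THEOREM `OrbitCert.check_sound`: every prime `n` outside the listed bases `p` is eliminated. The bases ARE the
  orbit's residual exponents (plus small primes below the row's range); nothing is hidden in a gcd.

All checks are Boolean functions on lists of integers, evaluated by `decide`; all meaning lives in `Eliminated`.
References: [BS04] M. A. Bennett, C. M. Skinner, Canad. J. Math. 56 (2004) 23–54, §4; cell design note
`run/shared/lean/pub/pub-abcsig/lead/LEAN-SPEC.md`.
-/

namespace Summit.Ventures.AbcSig

open Polynomial

/-! ## Orbit data and the statement being certified -/

/-- One certified Hecke eigenvalue of a newform orbit: at the prime `ell`, `d * c_ell = g(θ)` with `g ∈ ℤ[x]`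
(little-endian coefficients) and `d ≠ 0` the common denominator of the `θ`-coordinates of `c_ell`. -/
structure CoeffEntry where
  /-- the prime `ℓ` -/
  ell : ℕ
  /-- denominator `d` (intended `d ≥ 1`) -/
  d : ℤ
  /-- numerator polynomial: `d · c_ℓ = g(θ)` -/
  g : List ℤ
  deriving DecidableEq, Repr

/-- Certified data of one Galois orbit of newforms: the field polynomial `F` (`F(θ) = 0`, `θ` a chosen generator of
the Hecke order) and finitely many eigenvalue entries. Produced by the cell's engines; two-engine agreement is the
(external) certificate that it is correct and complete. -/
structure OrbitData where
  /-- polynomial with `F(θ) = 0` (the Hecke field polynomial; only `F(θ) = 0` is ever used) -/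
  F : List ℤ
  /-- eigenvalue entries `(ℓ, d, g)` -/
  coeffs : List CoeffEntry
  deriving Repr

/-- `o.Realises A n φ`: the ring homomorphism `φ : ℤ[X] →+* k` is a mod-`n` REALISATION of the orbit data with traces
in the allowed sets: `φ(F) = 0` and, at every listed prime `ℓ ≠ n`, `φ(g_ℓ) = d_ℓ · t` for some `t ∈ A(ℓ)`.
(Intended: `φ = (reduction mod ν) ∘ (x ↦ θ)` for a prime `ν | n` of the coefficient ring of a newform in the orbit,
`t = ` trace of Frobenius at `ℓ` of the Frey curve.) -/
def OrbitData.Realises (o : OrbitData) (A : ℕ → List ℤ) (n : ℕ) {k : Type} [Field k] (φ : ℤ[X] →+* k) : Prop :=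
  φ (toPoly o.F) = 0 ∧ ∀ e ∈ o.coeffs, e.ell ≠ n → ∃ t ∈ A e.ell, φ (toPoly e.g) = (e.d : k) * (t : k)

/-- `o.Eliminated A n`: the orbit data admits NO mod-`n` realisation with traces in `A` in any field of
characteristic `n` — the conclusion a sieve certificate establishes for the exponent `n`. -/
def OrbitData.Eliminated (o : OrbitData) (A : ℕ → List ℤ) (n : ℕ) : Prop :=
  ∀ (k : Type) [Field k] [CharP k n] (φ : ℤ[X] →+* k), ¬ o.Realises A n φ

/-! ## Decision trees of Bézout witnesses -/

/-- A sieve decision tree. `leaf us r`: Bézout cofactors `us` and the certified integer `r` for the current generator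
list; `split i kids`: branch on the value `t` of entry `i` of the orbit data, `kids` = list of `(t, subtree)`. -/
inductive Tree where
  /-- close the branch: `Σ us[j] · gens[j] = r` -/
  | leaf (us : List (List ℤ)) (r : ℤ) : Tree
  /-- branch on entry `i`: one subtree per candidate trace `t` -/
  | split (i : ℕ) (kids : List (ℤ × Tree)) : Tree

/-- `mulOpt a b`: product in `Option ℕ` (`none` is failure). -/
def mulOpt : Option ℕ → Option ℕ → Option ℕ
  | some a, some b => some (a * b)
  | _, _ => none

/-- Product of a list of optional moduli, starting from `init`; `none` if any factor is `none`. -/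
def prodOpt (l : List (Option ℕ)) (init : ℕ) : Option ℕ := l.foldr mulOpt (some init)

/-- The generator added on the branch `t` of entry `e`: `g_e − d_e · t`. -/
def CoeffEntry.gen (e : CoeffEntry) (t : ℤ) : List ℤ := addL e.g [-(e.d * t)]

/-- **The checker.** `T.modulus fuel o A gens`: with `gens` the generators accumulated so far (initially `[o.F]`),
returns `some R` iff every leaf's Bézout identity holds and every split on entry `i` has a child for each
`t ∈ A(ℓ_i)`; then `R = ∏ (ℓ_i over splits) · ∏ (|r| over leaves)` (children not demanded by `A` are checked too and
contribute harmlessly). `fuel` bounds the depth (structural recursion on `ℕ`, so `decide` evaluates it). -/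
def Tree.modulus : ℕ → Tree → OrbitData → (ℕ → List ℤ) → List (List ℤ) → Option ℕ
  | 0, _, _, _, _ => none
  | _ + 1, .leaf us r, _, _, gens => if bezoutCheck gens us r then some r.natAbs else none
  | fuel + 1, .split i kids, o, A, gens =>
      match o.coeffs[i]? with
      | none => none
      | some e =>
          if (A e.ell).all (fun t => kids.any (fun kt => kt.1 == t)) then
            prodOpt (kids.map (fun kt => Tree.modulus fuel kt.2 o A (gens ++ [e.gen kt.1]))) e.ell
          else none

/-- Unfolding `prodOpt` on a cons. -/
lemma prodOpt_cons (m : Option ℕ) (l : List (Option ℕ)) (init : ℕ) :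
    prodOpt (m :: l) init = mulOpt m (prodOpt l init) := rfl

/-- If a product of optional moduli is `some R` then `init ∣ R` and every factor is `some x` with `x ∣ R`. -/
lemma prodOpt_eq_some : ∀ (l : List (Option ℕ)) (init R : ℕ), prodOpt l init = some R →
    init ∣ R ∧ ∀ m ∈ l, ∃ x, m = some x ∧ x ∣ R
  | [], init, R, h => by
      simp only [prodOpt, List.foldr_nil, Option.some.injEq] at h
      subst h
      simp
  | m :: l, init, R, h => by
      rw [prodOpt_cons] at h
      cases m with
      | none => simp [mulOpt] at h
      | some a =>
          cases hl : prodOpt l init with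
          | none => simp [hl, mulOpt] at h
          | some b =>
              rw [hl] at h
              simp only [mulOpt, Option.some.injEq] at h
              obtain ⟨hinit, hrest⟩ := prodOpt_eq_some l init b hl
              subst h
              refine ⟨hinit.trans (Dvd.intro_left _ rfl), ?_⟩
              intro m hm
              rcases List.mem_cons.mp hm with rfl | hm
              · exact ⟨a, rfl, Dvd.intro _ rfl⟩
              · obtain ⟨x, hx, hxb⟩ := hrest m hm
                exact ⟨x, hx, hxb.trans (Dvd.intro_left _ rfl)⟩

/-- A homomorphism sending `g_e` to `d_e · t` kills the branch generator `g_e − d_e · t`. -/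
lemma CoeffEntry.map_gen_eq_zero (e : CoeffEntry) (t : ℤ) {k : Type} [Field k] (φ : ℤ[X] →+* k)
    (h : φ (toPoly e.g) = (e.d : k) * (t : k)) : φ (toPoly (e.gen t)) = 0 := by
  simp [CoeffEntry.gen, toPoly_addL, map_add, h]

/-- **Soundness of the checker.** If `T.modulus fuel o A gens = some R` then for every prime `n ∤ R` there is no
ring homomorphism `φ : ℤ[X] → k` (`k` a field of characteristic `n`) killing `gens` and realising the allowed traces at
all listed primes `ℓ ≠ n`. Proof: induction on `fuel`; a leaf is `bezout_elim`; at a split on entry `e`, `ℓ_e ∣ R`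
forces `n ≠ ℓ_e`, so `φ(g_e) = d_e t` for some `t ∈ A(ℓ_e)`, the child for `t` exists by the coverage test, its
modulus divides `R`, and the induction hypothesis applies with the extra generator `g_e − d_e t`. -/
theorem Tree.modulus_sound : ∀ (fuel : ℕ) (T : Tree) (o : OrbitData) (A : ℕ → List ℤ) (gens : List (List ℤ))
    (R : ℕ), T.modulus fuel o A gens = some R → ∀ (n : ℕ), n.Prime → ¬ n ∣ R →
    ∀ (k : Type) [Field k] [CharP k n] (φ : ℤ[X] →+* k), (∀ P ∈ gens, φ (toPoly P) = 0) →
    (∀ e ∈ o.coeffs, e.ell ≠ n → ∃ t ∈ A e.ell, φ (toPoly e.g) = (e.d : k) * (t : k)) → False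
  | 0, T, o, A, gens, R, h, n, hn, hR, k, _, _, φ, hg, hA => by
      simp [Tree.modulus] at h
  | fuel + 1, .leaf us r, o, A, gens, R, h, n, hn, hR, k, _, _, φ, hg, hA => by
      simp only [Tree.modulus] at h
      by_cases hb : bezoutCheck gens us r = true
      · rw [if_pos hb, Option.some.injEq] at h
        subst h
        exact bezout_elim hb n hR φ hg
      · rw [if_neg hb] at h
        exact absurd h (by simp)
  | fuel + 1, .split i kids, o, A, gens, R, h, n, hn, hR, k, _, _, φ, hg, hA => by
      simp only [Tree.modulus] at h
      split at h
      · simp at h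
      · rename_i e he
        by_cases hcov : (A e.ell).all (fun t => kids.any (fun kt => kt.1 == t)) = true
        swap
        · rw [if_neg hcov] at h
          exact absurd h (by simp)
        rw [if_pos hcov] at h
        obtain ⟨hell, hkids⟩ := prodOpt_eq_some _ _ _ h
        have he_mem : e ∈ o.coeffs := List.mem_of_getElem? he
        have hne : e.ell ≠ n := by
          rintro rfl
          exact hR hell
        obtain ⟨t, ht, hφ⟩ := hA e he_mem hne
        have hcov' := List.all_eq_true.mp hcov t ht
        obtain ⟨kt, hkt, hkt1⟩ := List.any_eq_true.mp hcov'
        have hkt1' : kt.1 = t := by simpa using hkt1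
        obtain ⟨x, hx, hxR⟩ := hkids (Tree.modulus fuel kt.2 o A (gens ++ [e.gen kt.1]))
          (List.mem_map.mpr ⟨kt, hkt, rfl⟩)
        refine Tree.modulus_sound fuel kt.2 o A (gens ++ [e.gen kt.1]) x hx n hn
          (fun hnx => hR (hnx.trans hxR)) k φ ?_ hA
        intro P hP
        rcases List.mem_append.mp hP with hP | hP
        · exact hg P hP
        · rw [List.mem_singleton] at hP
          subst hP
          rw [hkt1']
          exact e.map_gen_eq_zero t φ hφ

/-- A tree certificate with modulus `R` (run from the generator list `[F]`) eliminates every prime exponent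
`n ∤ R`. -/
theorem OrbitData.eliminated_of_modulus (o : OrbitData) (A : ℕ → List ℤ) (T : Tree) (fuel R : ℕ)
    (h : T.modulus fuel o A [o.F] = some R) (n : ℕ) (hn : n.Prime) (hR : ¬ n ∣ R) : o.Eliminated A n := by
  intro k _ _ φ hφ
  exact Tree.modulus_sound fuel T o A [o.F] R h n hn hR k φ (by simpa using hφ.1) hφ.2

/-! ## Orbit certificates: several trees and the exact residual primes -/

/-- A full certificate for one orbit: trees, integers `zs`, and a prime-power factorisation `fac` of
`Σ zs[j] · modulus(trees[j])`. The bases of `fac` are, by `check_sound`, the ONLY primes that can fail to be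
eliminated (the orbit's residual exponents together with the small primes below the row's range). -/
structure OrbitCert where
  /-- depth bound for the trees -/
  fuel : ℕ
  /-- the decision trees, each run from `[F]` -/
  trees : List Tree
  /-- integer coefficients of the relation `Σ zs[j] · R_j = ∏ p^e` -/
  zs : List ℤ
  /-- `(p, e)` pairs: the right-hand side `∏ p^e`, every `p` prime -/
  fac : List (ℕ × ℕ)

/-- `Σ zs[j] · Rs[j]` (extra entries of the longer list ignored). -/
def dotZ : List ℤ → List ℕ → ℤ
  | z :: zs, R :: Rs => z * (R : ℤ) + dotZ zs Rs
  | _, _ => 0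

/-- `∏ p^e` over a list of `(p, e)`. -/
def facProd (fac : List (ℕ × ℕ)) : ℕ := (fac.map fun pe => pe.1 ^ pe.2).prod

/-- `allSome l`: `some` of the list of values if every entry is `some`, else `none` (structural, kernel-friendly). -/
def allSome : List (Option ℕ) → Option (List ℕ)
  | [] => some []
  | none :: _ => none
  | some a :: l =>
      match allSome l with
      | none => none
      | some Rs => some (a :: Rs)

/-- Every member of `allSome l` comes from a `some` entry of `l`. -/
lemma some_mem_of_allSome : ∀ (l : List (Option ℕ)) (Rs : List ℕ), allSome l = some Rs → ∀ R ∈ Rs, some R ∈ l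
  | [], Rs, h, R, hR => by
      simp only [allSome, Option.some.injEq] at h
      subst h
      simp at hR
  | none :: l, Rs, h, R, hR => by simp [allSome] at h
  | some a :: l, Rs, h, R, hR => by
      simp only [allSome] at h
      split at h
      · simp at h
      · rename_i Rs' hl
        simp only [Option.some.injEq] at h
        subst h
        rcases List.mem_cons.mp hR with rfl | hR
        · simp
        · exact List.mem_cons_of_mem _ (some_mem_of_allSome l Rs' hl R hR)

/-- Collect the moduli of all trees of a certificate (`none` if any tree fails). -/
def OrbitCert.moduli (c : OrbitCert) (o : OrbitData) (A : ℕ → List ℤ) : Option (List ℕ) :=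
  allSome (c.trees.map fun T => T.modulus c.fuel o A [o.F])

/-- **Orbit certificate check** (computable, evaluated by `decide`): all trees succeed with moduli `R_j`,
`Σ zs[j] · R_j = ∏ p^e`, and every base `p` of `fac` is prime (kernel-friendly trial division,
`Nat.decidablePrime`). -/
def OrbitCert.check (c : OrbitCert) (o : OrbitData) (A : ℕ → List ℤ) : Bool :=
  match c.moduli o A with
  | none => false
  | some Rs => (dotZ c.zs Rs == (facProd c.fac : ℤ)) && c.fac.all (fun pe => decide (pe.1.Prime))

/-- If `n` divides every modulus it divides `dotZ zs Rs`. -/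
lemma dvd_dotZ (n : ℕ) : ∀ (zs : List ℤ) (Rs : List ℕ), (∀ R ∈ Rs, n ∣ R) → (n : ℤ) ∣ dotZ zs Rs
  | [], [], _ => by simp [dotZ]
  | [], _ :: _, _ => by simp [dotZ]
  | _ :: _, [], _ => by simp [dotZ]
  | z :: zs, R :: Rs, h => by
      simp only [dotZ]
      refine dvd_add (Dvd.dvd.mul_left ?_ z) (dvd_dotZ n zs Rs (fun R' hR' => h R' (by simp [hR'])))
      exact Int.natCast_dvd_natCast.mpr (h R (by simp))

/-- A prime dividing `∏ p^e` with all `p` prime is one of the `p`. -/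
lemma mem_bases_of_prime_dvd_facProd {n : ℕ} (hn : n.Prime) :
    ∀ (fac : List (ℕ × ℕ)), (∀ pe ∈ fac, pe.1.Prime) → n ∣ facProd fac → n ∈ fac.map Prod.fst
  | [], _, h => by
      simp only [facProd, List.map_nil, List.prod_nil, Nat.dvd_one] at h
      exact absurd h hn.one_lt.ne'
  | pe :: fac, hprime, h => by
      simp only [facProd, List.map_cons, List.prod_cons] at h
      rcases (Nat.Prime.dvd_mul hn).mp h with h | h
      · have hp : pe.1.Prime := hprime pe (by simp)
        have := (Nat.prime_dvd_prime_iff_eq hn hp).mp (hn.dvd_of_dvd_pow h)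
        simp [this]
      · have := mem_bases_of_prime_dvd_facProd hn fac (fun q hq => hprime q (by simp [hq])) h
        simp only [List.map_cons, List.mem_cons]
        exact Or.inr this

/-- **Soundness of an orbit certificate.** If `c.check o A = true` then every prime `n` that is not a base of
`c.fac` satisfies `o.Eliminated A n`. Proof: if `n` divided every tree modulus it would divide
`Σ zs[j] R_j = ∏ p^e`, hence equal some base; so some tree has `n ∤ R_j`, and `eliminated_of_modulus` applies. -/
theorem OrbitCert.check_sound (c : OrbitCert) (o : OrbitData) (A : ℕ → List ℤ) (h : c.check o A = true)
    (n : ℕ) (hn : n.Prime) (hmem : n ∉ c.fac.map Prod.fst) : o.Eliminated A n := by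
  unfold OrbitCert.check at h
  split at h
  · simp at h
  · rename_i Rs hRs
    simp only [Bool.and_eq_true, beq_iff_eq, List.all_eq_true, decide_eq_true_eq] at h
    obtain ⟨hdot, hprime⟩ := h
    by_contra hne
    apply hmem
    apply mem_bases_of_prime_dvd_facProd hn c.fac hprime
    have hall : ∀ R ∈ Rs, n ∣ R := by
      intro R hR
      by_contra hnR
      have hsome := some_mem_of_allSome _ Rs hRs R hR
      obtain ⟨T, _, hT⟩ := List.mem_map.mp hsome
      exact hne (o.eliminated_of_modulus A T c.fuel R hT n hn hnR)
    rw [← Int.natCast_dvd_natCast, ← hdot]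
    exact dvd_dotZ n c.zs Rs hall

/-! ## Toy certificate (kernel-evaluated): `F = x² − 2`, one entry `ℓ = 3`, `c₃ = θ` (`d = 1`, `g = x`), allowed
traces `{0, 2}` only (a TOY allowed set): `2 ∈ (F, x)`, `2 ∈ (F, x − 2)` (`F − (x+2)(x−2) = 2`) — modulus
`3·2·2 = 12 = 2²·3`, so every prime `n ≥ 5` is eliminated for this toy. -/

/-- Toy orbit data. -/
def toyOrbit : OrbitData := { F := [-2, 0, 1], coeffs := [⟨3, 1, [0, 1]⟩] }

/-- Toy allowed sets. -/
def toyAllowed : ℕ → List ℤ := fun _ => [0, 2]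

/-- Toy certificate: one depth-one tree, relation `1 · 12 = 2² · 3`. -/
def toyCert : OrbitCert :=
  { fuel := 2
    trees := [.split 0 [(0, .leaf [[-1], [0, 1]] 2), (2, .leaf [[1], [-2, -1]] 2)]]
    zs := [1]
    fac := [(2, 2), (3, 1)] }

/-- The toy certificate passes the checker (evaluated by the kernel). -/
example : toyCert.check toyOrbit toyAllowed = true := by decide

/-- Hence, e.g., the toy orbit data is eliminated for the exponent `7`. -/
example : toyOrbit.Eliminated toyAllowed 7 :=
  toyCert.check_sound toyOrbit toyAllowed (by decide) 7 (by norm_num) (by decide)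

end Summit.Ventures.AbcSig
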